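import Mathlib.LinearAlgebra.Trace
import Mathlib.LinearAlgebra.FiniteDimensional.Defs
import Mathlib.Tactic.NoncommRing
import Mathlib.Tactic.Ring
import HarnessLib

/-!
# Finite projective Weyl systems with scalar commutant: the Reynolds identity and the trace of a normalising operator

Topic `RepresentationTheory/HeisenbergGroup`; namespace `Literature.RepresentationTheory.HeisenbergGroup.FiniteWeyl`.
KERNEL ONLY (theorems over Mathlib; no definition, no named fact, no `sorry`).

Setting (the finite-dimensional skeleton of [MoeglinVignerasWaldspurger1987, Chap. 2 I.3–I.6]: the Heisenberg group of a
finite symplectic module `𝒱 = A^⊥/A` acting on the space `S(ψ_A)` of `(A, ψ_A)`-eigenvectors of a model of the Weil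
representation).  `k` a field, `V` a finite-dimensional `k`-space, `G` a finite additive commutative group, and a
**projective Weyl system**: operators `R x ∈ End_k(V)` (`x ∈ G`) with `R 0 = 1` and `R x * R y = ε x y • R (x + y)` for
non-zero scalars `ε x y`, together with a chosen family of inverses `S x` (`R x * S x = 1`).  Results:

* §1 bookkeeping: `S x * R x = 1`, `S y * S x = (ε x y)⁻¹ • S (x + y)`, conjugation `X ↦ R y * X * S y` composes
  additively in `y` (the scalars cancel), and the trace of a Weyl operator with a non-trivial commutator scalar vanishes
  (`trace_weyl_eq_zero_of_conj`);
* §2 **the Reynolds identity** (`finrank_smul_sum_conj_eq`): if the commutant of `{R x}` in `End_k(V)` is `k` then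
  `(dim V) • Σ_y R y * X * S y = (|G| · tr X) • 1` for every `X` — Schur's lemma applied to the `G`-average;
* §3 **the trace of a normalising operator** (`card_mul_trace_mul_trace_eq`): if `T` is invertible with
  `T * R y * T⁻¹ = λ y • R (σ y)` for a map `σ : G → G` and scalars `λ y`, and Weyl operators of index `x ≠ 0` have a
  non-trivial commutator scalar, then `|G| · tr T · tr T⁻¹ = (dim V)² · Σ_{σ y = y} (λ y)⁻¹`; in particular
  (`trace_ne_zero_of_fixedPoints_eq_zero`) **`tr T ≠ 0` as soon as `σ` fixes only `0`** (`char k = 0`, `V ≠ 0`).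

This is the linear algebra behind «the character of the oscillator representation at an element `t` of a compact torus with
`t − 1` a unit has absolute value `1`» (the finite Heisenberg group sees `t` as an automorphism of `A^⊥/A` without non-zero
fixed points), recorded for the cell `hodgecm-mathlib` (rank `1 × 1` non-periodicity of the oscillator representation,
[MoeglinVignerasWaldspurger1987, Chap. 3 IV]); nothing of the cited sources is asserted here.  NOT here: the Heisenberg
group itself, lattices, or any model — see `SchrodingerModel.lean`, `LocalWeilProjective.lean` in this directory.

## References
* [MoeglinVignerasWaldspurger1987] C. Mœglin, M.-F. Vignéras, J.-L. Waldspurger, *Correspondances de Howe sur un corps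
  p-adique*, LNM 1291 (1987), Chap. 2 I.3 (commutant `= ℂ`), I.6 (`S(ψ_A)`), II.2, II.8 (lattice models).
-/

set_option autoImplicit false

namespace Literature.RepresentationTheory.HeisenbergGroup.FiniteWeyl

open Module

section Basic

variable {k : Type*} [Field k] {V : Type*} [AddCommGroup V] [Module k V] [FiniteDimensional k V]
variable {G : Type*} (R S : G → Module.End k V)

/-! ## §1 Bookkeeping for a projective Weyl system -/

/-- a one-sided inverse in `End_k(V)`, `V` finite-dimensional, is two-sided. [folklore] -/
private theorem inv_mul_of_mul_inv (hS : ∀ x, R x * S x = 1) (x : G) : S x * R x = 1 :=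
  mul_eq_one_comm.1 (hS x)

/-- the trace is invariant under conjugation `X ↦ R y * X * S y`. [folklore] -/
private theorem trace_conj_eq (hS : ∀ x, R x * S x = 1) (X : Module.End k V) (y : G) :
    LinearMap.trace k V (R y * X * S y) = LinearMap.trace k V X := by
  rw [mul_assoc, LinearMap.trace_mul_comm, mul_assoc, inv_mul_of_mul_inv R S hS, mul_one]

/-- **a Weyl operator with a non-trivial commutator scalar has trace zero**: if `R z * R x * S z = c • R x` with `c ≠ 1`
then `tr (R x) = 0`. [cite: MoeglinVignerasWaldspurger1987, Chap. 2 I.3] -/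
theorem trace_weyl_eq_zero_of_conj (hS : ∀ x, R x * S x = 1) {x z : G} {c : k} (hc : c ≠ 1)
    (h : R z * R x * S z = c • R x) : LinearMap.trace k V (R x) = 0 := by
  have key := trace_conj_eq R S hS (R x) z
  rw [h, map_smul, smul_eq_mul] at key
  have h' : (c - 1) * LinearMap.trace k V (R x) = 0 := by rw [sub_mul, one_mul, key, sub_self]
  rcases mul_eq_zero.1 h' with h'' | h''
  · exact absurd (sub_eq_zero.1 h'') hc
  · exact h''

/-- if `T` is invertible and `T * R y * T⁻¹ = λ y • R (σ y)`, then `λ y ≠ 0` and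
`T * S y * T⁻¹ = (λ y)⁻¹ • S (σ y)`. [cite: MoeglinVignerasWaldspurger1987, Chap. 2 II.2] -/
theorem conj_inv_eq [Nontrivial V] (hS : ∀ x, R x * S x = 1) (T Tinv : Module.End k V) (hT : T * Tinv = 1)
    (σ : G → G)
    (lam : G → k) (hTR : ∀ y, T * R y * Tinv = lam y • R (σ y)) (y : G) :
    lam y ≠ 0 ∧ T * S y * Tinv = (lam y)⁻¹ • S (σ y) := by
  have hT' : Tinv * T = 1 := mul_eq_one_comm.1 hT
  have h1 : (T * R y * Tinv) * (T * S y * Tinv) = 1 := by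
    calc (T * R y * Tinv) * (T * S y * Tinv) = T * R y * (Tinv * T) * S y * Tinv := by noncomm_ring
      _ = 1 := by rw [hT', mul_one, mul_assoc T, hS, mul_one, hT]
  have hlam : lam y ≠ 0 := by
    intro h0
    rw [hTR, h0, zero_smul, zero_mul] at h1
    exact zero_ne_one h1
  refine ⟨hlam, ?_⟩
  have h2 : (T * R y * Tinv) * ((lam y)⁻¹ • S (σ y)) = 1 := by
    rw [hTR, smul_mul_smul_comm, hS, mul_inv_cancel₀ hlam, one_smul]
  -- two right inverses of the same element coincide
  have h1' : (T * S y * Tinv) * (T * R y * Tinv) = 1 := mul_eq_one_comm.1 h1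
  calc T * S y * Tinv = (T * S y * Tinv) * ((T * R y * Tinv) * ((lam y)⁻¹ • S (σ y))) := by rw [h2, mul_one]
    _ = (lam y)⁻¹ • S (σ y) := by rw [← mul_assoc, h1', one_mul]

variable [AddCommGroup G] (ε : G → G → k)

/-- the product of two Weyl operators is a non-zero multiple of a Weyl operator, so their chosen inverses multiply
accordingly: `S y * S x = (ε x y)⁻¹ • S (x + y)`. [cite: MoeglinVignerasWaldspurger1987, Chap. 2 I.3] -/
theorem inv_mul_inv_eq (hR : ∀ x y, R x * R y = ε x y • R (x + y)) (hε : ∀ x y, ε x y ≠ 0)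
    (hS : ∀ x, R x * S x = 1) (x y : G) : S y * S x = (ε x y)⁻¹ • S (x + y) := by
  -- both sides are right inverses of `R x * R y = ε x y • R (x + y)`
  have h1 : (R x * R y) * (S y * S x) = 1 := by
    rw [mul_assoc, ← mul_assoc (R y), hS y, one_mul, hS x]
  have h2 : (R x * R y) * ((ε x y)⁻¹ • S (x + y)) = 1 := by
    rw [hR, smul_mul_smul_comm, hS, mul_inv_cancel₀ (hε x y), one_smul]
  have h1' : (S y * S x) * (R x * R y) = 1 := mul_eq_one_comm.1 h1
  calc S y * S x = (S y * S x) * ((R x * R y) * ((ε x y)⁻¹ • S (x + y))) := by rw [h2, mul_one]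
    _ = (ε x y)⁻¹ • S (x + y) := by rw [← mul_assoc, h1', one_mul]

/-- conjugation by Weyl operators composes additively in the index (the commutator scalars cancel):
`R z * (R y * X * S y) * S z = R (z + y) * X * S (z + y)`. [cite: MoeglinVignerasWaldspurger1987, Chap. 2 I.3] -/
theorem conj_conj_eq (hR : ∀ x y, R x * R y = ε x y • R (x + y)) (hε : ∀ x y, ε x y ≠ 0)
    (hS : ∀ x, R x * S x = 1) (X : Module.End k V) (z y : G) :
    R z * (R y * X * S y) * S z = R (z + y) * X * S (z + y) := by
  calc R z * (R y * X * S y) * S z = (R z * R y) * X * (S y * S z) := by noncomm_ring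
    _ = (ε z y • R (z + y)) * X * ((ε z y)⁻¹ • S (z + y)) := by rw [hR, inv_mul_inv_eq R S ε hR hε hS z y]
    _ = R (z + y) * X * S (z + y) := by
      rw [smul_mul_assoc, smul_mul_assoc, mul_smul_comm, smul_smul, mul_inv_cancel₀ (hε z y), one_smul]

/-! ## §2 The Reynolds identity under a scalar commutant -/

variable [Fintype G]

/-- the `G`-average `Σ_y R y * X * S y` commutes with every Weyl operator. [cite: MoeglinVignerasWaldspurger1987, Chap. 2 I.3] -/
theorem sum_conj_comm (hR : ∀ x y, R x * R y = ε x y • R (x + y)) (hε : ∀ x y, ε x y ≠ 0)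
    (hS : ∀ x, R x * S x = 1) (X : Module.End k V) (z : G) :
    (∑ y, R y * X * S y) * R z = R z * ∑ y, R y * X * S y := by
  have key : R z * (∑ y, R y * X * S y) * S z = ∑ y, R y * X * S y := by
    rw [Finset.mul_sum, Finset.sum_mul]
    simp_rw [conj_conj_eq R S ε hR hε hS X z]
    exact Fintype.sum_equiv (Equiv.addLeft z) _ _ fun y => rfl
  calc (∑ y, R y * X * S y) * R z = (R z * (∑ y, R y * X * S y) * S z) * R z := by rw [key]
    _ = R z * ∑ y, R y * X * S y := by rw [mul_assoc, inv_mul_of_mul_inv R S hS, mul_one]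

/-- **Reynolds identity.**  If the commutant of the Weyl system is the scalars, then for every `X ∈ End_k(V)`
`(dim V) • Σ_y R y * X * S y = (|G| · tr X) • 1`. [cite: MoeglinVignerasWaldspurger1987, Chap. 2 I.3] -/
theorem finrank_smul_sum_conj_eq (hR : ∀ x y, R x * R y = ε x y • R (x + y)) (hε : ∀ x y, ε x y ≠ 0)
    (hS : ∀ x, R x * S x = 1)
    (hcomm : ∀ X : Module.End k V, (∀ y, X * R y = R y * X) → ∃ c : k, X = c • (1 : Module.End k V))
    (X : Module.End k V) :
    (finrank k V : k) • (∑ y, R y * X * S y) = ((Fintype.card G : k) * LinearMap.trace k V X) • (1 : Module.End k V) := by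
  obtain ⟨c, hc⟩ := hcomm (∑ y, R y * X * S y) fun z => sum_conj_comm R S ε hR hε hS X z
  have htr : LinearMap.trace k V (∑ y, R y * X * S y) = (Fintype.card G : k) * LinearMap.trace k V X := by
    rw [map_sum]
    simp_rw [trace_conj_eq R S hS X]
    rw [Finset.sum_const, Finset.card_univ, nsmul_eq_mul]
  rw [hc, map_smul, LinearMap.trace_one, smul_eq_mul] at htr
  rw [hc, smul_smul, mul_comm, htr]

/-! ## §3 The trace of a normalising operator -/

/-- **trace formula for a normalising operator.**  Weyl system with scalar commutant and non-degenerate commutator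
scalars (every `x ≠ 0` has some `z` with `R z * R x * S z = c • R x`, `c ≠ 1`); `T` invertible with
`T * R y * T⁻¹ = λ y • R (σ y)`.  Then `|G| · tr T · tr T⁻¹ = (dim V)² · Σ_{y : σ y = y} (λ y)⁻¹`.
[cite: MoeglinVignerasWaldspurger1987, Chap. 2 I.3, II.2] -/
theorem card_mul_trace_mul_trace_eq [DecidableEq G] [Nontrivial V] (hR : ∀ x y, R x * R y = ε x y • R (x + y))
    (hε : ∀ x y, ε x y ≠ 0) (hS : ∀ x, R x * S x = 1)
    (hcomm : ∀ X : Module.End k V, (∀ y, X * R y = R y * X) → ∃ c : k, X = c • (1 : Module.End k V))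
    (hnd : ∀ x : G, x ≠ 0 → ∃ (z : G) (c : k), c ≠ 1 ∧ R z * R x * S z = c • R x)
    (T Tinv : Module.End k V) (hT : T * Tinv = 1) (σ : G → G) (lam : G → k)
    (hTR : ∀ y, T * R y * Tinv = lam y • R (σ y)) :
    (Fintype.card G : k) * LinearMap.trace k V T * LinearMap.trace k V Tinv =
      (finrank k V : k) ^ 2 * ∑ y ∈ Finset.univ.filter (fun y => σ y = y), (lam y)⁻¹ := by
  -- Reynolds at `X = T`, multiplied on the right by `T⁻¹`
  have hrey := finrank_smul_sum_conj_eq R S ε hR hε hS hcomm T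
  have hrey' : (finrank k V : k) • (∑ y, R y * T * S y * Tinv) =
      ((Fintype.card G : k) * LinearMap.trace k V T) • Tinv := by
    have := congrArg (· * Tinv) hrey
    simpa only [smul_mul_assoc, one_mul, Finset.sum_mul] using this
  -- each summand is `(λ y)⁻¹ • (R y * S (σ y))`
  have hterm : ∀ y, R y * T * S y * Tinv = (lam y)⁻¹ • (R y * S (σ y)) := by
    intro y
    rw [mul_assoc (R y), mul_assoc (R y), (conj_inv_eq R S hS T Tinv hT σ lam hTR y).2, mul_smul_comm]
  simp_rw [hterm] at hrey'
  -- traces of the summands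
  have htr : ∀ y, LinearMap.trace k V (R y * S (σ y)) = if σ y = y then (finrank k V : k) else 0 := by
    intro y
    split_ifs with h
    · rw [h, hS, LinearMap.trace_one]
    · -- `R y * S (σ y)` is a non-zero multiple of `R (y - σ y)`, a Weyl operator of non-zero index
      have hy : y - σ y ≠ 0 := sub_ne_zero.2 (Ne.symm h)
      obtain ⟨z, c, hc, hz⟩ := hnd _ hy
      have e1 : R (y - σ y) * R (σ y) = ε (y - σ y) (σ y) • R y := by rw [hR, sub_add_cancel]
      have e2 : R (y - σ y) = ε (y - σ y) (σ y) • (R y * S (σ y)) := by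
        have := congrArg (· * S (σ y)) e1
        simpa only [mul_assoc, hS, mul_one, smul_mul_assoc] using this
      have e3 : R y * S (σ y) = (ε (y - σ y) (σ y))⁻¹ • R (y - σ y) := by
        rw [e2, smul_smul, inv_mul_cancel₀ (hε _ _), one_smul]
      rw [e3, map_smul, trace_weyl_eq_zero_of_conj R S hS hc hz, smul_zero]
  have key := congrArg (LinearMap.trace k V) hrey'
  rw [map_smul, map_sum, map_smul, smul_eq_mul, smul_eq_mul] at key
  simp_rw [map_smul, htr, smul_eq_mul, mul_ite, mul_zero] at key
  rw [Finset.sum_ite, Finset.sum_const_zero, add_zero] at key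
  -- `key : d * Σ_{σ y = y} (λ y)⁻¹ * d = (|G| tr T) * tr T⁻¹`
  rw [← key, Finset.mul_sum, Finset.mul_sum]
  refine Finset.sum_congr rfl fun y _ => ?_
  ring

/-- **non-vanishing of the trace.**  Under the hypotheses of `card_mul_trace_mul_trace_eq`, over a field of characteristic
zero and with `V ≠ 0`: if `σ` fixes no index other than `0`, then `|G| · tr T · tr T⁻¹ = (dim V)²`, in particular
`tr T ≠ 0`. [cite: MoeglinVignerasWaldspurger1987, Chap. 2 I.3, II.2] -/
theorem trace_ne_zero_of_fixedPoints_eq_zero [DecidableEq G] [CharZero k] [Nontrivial V]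
    (hR : ∀ x y, R x * R y = ε x y • R (x + y)) (hε : ∀ x y, ε x y ≠ 0) (hR0 : R 0 = 1)
    (hS : ∀ x, R x * S x = 1)
    (hcomm : ∀ X : Module.End k V, (∀ y, X * R y = R y * X) → ∃ c : k, X = c • (1 : Module.End k V))
    (hnd : ∀ x : G, x ≠ 0 → ∃ (z : G) (c : k), c ≠ 1 ∧ R z * R x * S z = c • R x)
    (T Tinv : Module.End k V) (hT : T * Tinv = 1) (σ : G → G) (lam : G → k)
    (hTR : ∀ y, T * R y * Tinv = lam y • R (σ y)) (hσ : ∀ y, σ y = y ↔ y = 0) :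
    (Fintype.card G : k) * LinearMap.trace k V T * LinearMap.trace k V Tinv = (finrank k V : k) ^ 2 ∧
      LinearMap.trace k V T ≠ 0 := by
  have hmain := card_mul_trace_mul_trace_eq R S ε hR hε hS hcomm hnd T Tinv hT σ lam hTR
  have hfilter : Finset.univ.filter (fun y => σ y = y) = {0} := by
    ext y
    simp [hσ y]
  have hd : (finrank k V : k) ≠ 0 := Nat.cast_ne_zero.2 Module.finrank_pos.ne'
  have hlam0 : lam 0 = 1 := by
    have h := hTR 0
    rw [hR0, mul_one, hT, (hσ 0).2 rfl, hR0] at h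
    -- `h : 1 = lam 0 • 1` in `End V`, `V ≠ 0`
    have h' := congrArg (LinearMap.trace k V) h
    rw [map_smul, LinearMap.trace_one, smul_eq_mul] at h'
    have h'' : (lam 0 - 1) * (finrank k V : k) = 0 := by rw [sub_mul, one_mul, ← h', sub_self]
    exact sub_eq_zero.1 ((mul_eq_zero.1 h'').resolve_right hd)
  rw [hfilter, Finset.sum_singleton, hlam0, inv_one, mul_one] at hmain
  refine ⟨hmain, fun h0 => ?_⟩
  rw [h0, mul_zero, zero_mul] at hmain
  exact pow_ne_zero 2 hd hmain.symm

end Basic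

end Literature.RepresentationTheory.HeisenbergGroup.FiniteWeyl
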